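import Summits.HodgeConjecture.HodgeConjecture.Theorems.CorCMDomination
import Literature.AlgebraicGeometry.ComplexMultiplication.PrincipalModelOfCMOrder
import Literature.AlgebraicGeometry.Motives.AbelianVarietyProductDimProofs
import Literature.AlgebraicGeometry.Motives.AbelianVarietyDimZeroProofs
import HarnessLib

/-!
# COR-CM (cell `pub-hodgecm2`), André ↦ Riemann, part 2: finite biproducts of abelian varieties —
# dimension and domination

HONEST FRAMING: bookkeeping for the finite biproducts `⨁ f` of `AbelianVariety ℂ` (which exist by
`AbelianVariety.hasFiniteBiproducts_inst`, Mumford §19): the dimension of a `Fin m`-indexed biproduct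
is the sum of the dimensions, and the "direct factor up to isogeny" relation
`Domination.AVDominatedBy A P` (`∃ s π N, N ≠ 0 ∧ s ≫ π = N • 𝟙 A`, file
`Theorems/CorCMDomination.lean`) is compatible with biproducts (sums of index types, reindexing,
singletons, dimension zero). Used by the decomposition step of
`DeligneMilne1982_Thm_6_20_full → Andre1992_…_weilClasses`. One abbreviation (`sumFam`, the
family on `J₁ ⊕ J₂` glued by pattern matching, so that `sumFam C₁ C₂ (inl j)` reduces to `C₁ j`
syntactically), no named facts.

## References
* [MumfordAV1970] D. Mumford, *Abelian Varieties*, §19 (products of abelian varieties; isogenies).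
* [GortzWedhorn2020] U. Görtz, T. Wedhorn, *Algebraic Geometry I*, Lemma 6.26 (dimension of products).
-/

noncomputable section

open CategoryTheory CategoryTheory.Limits

namespace Summit.HodgeConjecture.CorCM.AndreRiemann

open Literature.AlgebraicGeometry.Motives Literature.AlgebraicGeometry.Motives.AbelianVariety
open Summit.HodgeConjecture.CorCM.Domination

universe u

/-! ## §1 Dimension of a finite biproduct -/

section Dim

variable {K : Type u} [Field K]

/-- A biproduct indexed by `Fin 0` has dimension `0` (its identity is `0`, which is not an isogeny
in positive dimension). [cite: MumfordAV1970, §19] -/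
theorem dim_biproduct_fin_zero (f : Fin 0 → AbelianVariety K) : (⨁ f).dim = 0 := by
  by_contra h
  have hid : (𝟙 (⨁ f) : ⨁ f ⟶ ⨁ f) = 0 := biproduct.hom_ext _ _ fun j => Fin.elim0 j
  exact not_isIsogeny_zero_of_dim_pos (Nat.pos_of_ne_zero h) (hid ▸ isIsogeny_id (⨁ f))

/-- The comparison `⨁_{Fin (m+1)} f ⟶ f 0 × ⨁_{Fin m} (f ∘ succ)`. [cite: MumfordAV1970, §19] -/
theorem biproduct_succ_split {m : ℕ} (f : Fin (m + 1) → AbelianVariety K) :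
    ∃ (h : (⨁ f) ⟶ (f 0).prod (⨁ (f ∘ Fin.succ))) (g : (f 0).prod (⨁ (f ∘ Fin.succ)) ⟶ ⨁ f),
      h ≫ g = 𝟙 _ ∧ g ≫ h = 𝟙 _ := by
  refine ⟨prodLift (biproduct.π f 0) (biproduct.lift fun i => biproduct.π f i.succ),
    biproduct.lift fun j => Fin.cases (fst _ _) (fun i => snd _ _ ≫ biproduct.π (f ∘ Fin.succ) i) j,
    ?_, ?_⟩
  · refine biproduct.hom_ext _ _ fun j => ?_
    rw [Category.assoc, biproduct.lift_π, Category.id_comp]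
    refine Fin.cases ?_ (fun i => ?_) j
    · exact prodLift_fst _ _
    · change prodLift _ _ ≫ snd _ _ ≫ biproduct.π (f ∘ Fin.succ) i = biproduct.π f i.succ
      rw [← Category.assoc, prodLift_snd, biproduct.lift_π]
  · refine prod_hom_ext (by rw [Category.assoc, prodLift_fst, biproduct.lift_π, Category.id_comp]; rfl) ?_
    rw [Category.assoc, prodLift_snd, Category.id_comp]
    refine biproduct.hom_ext _ _ fun i => ?_
    rw [Category.assoc, biproduct.lift_π]
    exact biproduct.lift_π _ _

/-- **`dim (⨁_{Fin m} f) = Σ_i dim (f i)`** (Mumford §19; Görtz–Wedhorn I, Lemma 6.26 for binary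
products, iterated along `⨁_{Fin (m+1)} f ≅ f 0 × ⨁_{Fin m} (f ∘ succ)`).
[cite: MumfordAV1970, §19] [cite: GortzWedhorn2020, Lemma 6.26] -/
theorem dim_biproduct_fin {m : ℕ} : ∀ (f : Fin m → AbelianVariety K), (⨁ f).dim = ∑ i, (f i).dim := by
  induction m with
  | zero =>
    intro f
    rw [dim_biproduct_fin_zero, Finset.univ_eq_empty, Finset.sum_empty]
  | succ m ih =>
    intro f
    obtain ⟨h, g, hhg, hgh⟩ := biproduct_succ_split f
    have hh : IsIsogeny h :=
      isIsogeny_of_comp_eq_of_comp_eq (isIsogeny_id _) (isIsogeny_id _) hgh hhg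
    rw [dim_eq_of_isIsogeny hh, dim_prod, ih (f ∘ Fin.succ), Fin.sum_univ_succ]
    rfl

/-- The dimension of a constant biproduct `⨁_{Fin m} B` is `m · dim B`. [cite: MumfordAV1970, §19] -/
theorem dim_biproduct_const (B : AbelianVariety K) (m : ℕ) :
    (⨁ fun _ : Fin m => B).dim = m * B.dim := by
  rw [dim_biproduct_fin, Finset.sum_const, Finset.card_univ, Fintype.card_fin, smul_eq_mul]

end Dim

/-! ## §2 Domination and biproducts -/

section Domination

/-- The family on `J₁ ⊕ J₂` obtained by gluing `C₁` on `J₁` and `C₂` on `J₂` (pattern matching, so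
that `sumFam C₁ C₂ (inl j)` is `C₁ j` by `rfl` at reducible transparency). [cite: MumfordAV1970, §19] -/
abbrev sumFam {X : Type*} {J₁ J₂ : Type} (C₁ : J₁ → X) (C₂ : J₂ → X) : J₁ ⊕ J₂ → X :=
  fun j => match j with
    | Sum.inl j => C₁ j
    | Sum.inr j => C₂ j

/-- A biproduct over a sum of index types dominates the binary product of the two partial
biproducts (they are isomorphic). [cite: MumfordAV1970, §19] -/
theorem avDominatedBy_prod_biproduct_sum {J₁ J₂ : Type} [Fintype J₁] [Fintype J₂]
    (C₁ : J₁ → AbelianVariety ℂ) (C₂ : J₂ → AbelianVariety ℂ) :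
    AVDominatedBy ((⨁ C₁).prod (⨁ C₂)) (⨁ (sumFam C₁ C₂)) := by
  classical
  refine ⟨biproduct.lift fun j => match j with
      | Sum.inl j => fst _ _ ≫ biproduct.π C₁ j
      | Sum.inr j => snd _ _ ≫ biproduct.π C₂ j,
    prodLift (biproduct.lift fun j => biproduct.π (sumFam C₁ C₂) (Sum.inl j))
      (biproduct.lift fun j => biproduct.π (sumFam C₁ C₂) (Sum.inr j)),
    1, one_ne_zero, ?_⟩
  rw [one_smul]
  refine prod_hom_ext ?_ ?_
  · rw [Category.assoc, prodLift_fst, Category.id_comp]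
    refine biproduct.hom_ext _ _ fun j => ?_
    rw [Category.assoc, biproduct.lift_π, biproduct.lift_π]
  · rw [Category.assoc, prodLift_snd, Category.id_comp]
    refine biproduct.hom_ext _ _ fun j => ?_
    rw [Category.assoc, biproduct.lift_π, biproduct.lift_π]

/-- **Domination by biproducts is compatible with binary products**: if `A` is dominated by `⨁ C₁`
and `B` by `⨁ C₂` then `A × B` is dominated by `⨁ (C₁ ⊔ C₂)`. [cite: MumfordAV1970, §19] -/
theorem avDominatedBy_prod_of_biproduct {A B : AbelianVariety ℂ} {J₁ J₂ : Type} [Fintype J₁]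
    [Fintype J₂] {C₁ : J₁ → AbelianVariety ℂ} {C₂ : J₂ → AbelianVariety ℂ}
    (h₁ : AVDominatedBy A (⨁ C₁)) (h₂ : AVDominatedBy B (⨁ C₂)) :
    AVDominatedBy (A.prod B) (⨁ (sumFam C₁ C₂)) :=
  (h₁.prod h₂).trans (avDominatedBy_prod_biproduct_sum C₁ C₂)

/-- Every abelian variety is dominated by the one-term biproduct over itself. [cite: MumfordAV1970, §19] -/
theorem avDominatedBy_biproduct_single (B : AbelianVariety ℂ) :
    AVDominatedBy B (⨁ fun _ : Fin 1 => B) :=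
  ⟨biproduct.lift fun _ => 𝟙 B, biproduct.π _ 0, 1, one_ne_zero, by
    rw [biproduct.lift_π, one_smul]⟩

/-- Domination is insensitive to reindexing the dominating biproduct along an equivalence.
[cite: MumfordAV1970, §19] -/
theorem avDominatedBy_biproduct_reindex {A : AbelianVariety ℂ} {J : Type} [Fintype J] {n : ℕ}
    (e : Fin n ≃ J) {C : J → AbelianVariety ℂ} (h : AVDominatedBy A (⨁ C)) :
    AVDominatedBy A (⨁ (C ∘ e)) :=
  h.of_iso_right (biproduct.reindex e C).symm

/-- An abelian variety of dimension `0` is dominated by every abelian variety (all its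
endomorphisms vanish, `hom_eq_zero_of_dim_eq_zero`). [cite: MumfordAV1970, §19] -/
theorem avDominatedBy_of_dim_eq_zero {A : AbelianVariety ℂ} (hA : A.dim = 0) (P : AbelianVariety ℂ) :
    AVDominatedBy A P :=
  ⟨0, 0, 1, one_ne_zero, by rw [comp_zero, hom_eq_zero_of_dim_eq_zero (Or.inl hA) (1 • 𝟙 A)]⟩

/-- A direct factor of a biproduct: `B` is dominated by `B′` as soon as an isogeny `u : Bᵐ → B′`
exists out of a power with `m ≥ 1` (slot `0` in, quasi-inverse out). [cite: MumfordAV1970, §19 (remark before Thm. 1, p. 169)] -/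
theorem avDominatedBy_of_isIsogenous_pow {B B' : AbelianVariety ℂ} {m : ℕ} (hm : 0 < m)
    (h : IsIsogenous (⨁ fun _ : Fin m => B) B') : AVDominatedBy B B' := by
  obtain ⟨u, hu⟩ := h
  obtain ⟨v, n, hn, huv, -⟩ := IsIsogeny.exists_nsmul_inverse_holds hu
  refine ⟨biproduct.ι (fun _ : Fin m => B) ⟨0, hm⟩ ≫ u, v ≫ biproduct.π (fun _ : Fin m => B) ⟨0, hm⟩,
    n, hn.ne', ?_⟩
  rw [Category.assoc, ← Category.assoc u, huv, Preadditive.nsmul_comp, Category.id_comp,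
    Preadditive.comp_nsmul, biproduct.ι_π_self]

end Domination

end Summit.HodgeConjecture.CorCM.AndreRiemann

end
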